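import Mathlib
import Literature.Analysis.UnboundedOperators.HeatExtensionDecay
import Literature.Analysis.UnboundedOperators.HeatKernelTimeModulus

/-!
# Route PlaneEnergyCeiling · crux `PlanarEnergyAPriori` — decay persistence, file 2:
# polynomial decay of the caloric extension, and continuity at the base time

Helper file for the crux item stmt-NavierStokesRegularity-16855 (`PlanarEnergyAPriori`, route
`PlaneEnergyCeiling`), landed `--supports` that item, on the proof path of the registered stub
`stub_decayPersistence` of the line `birth`. Along the Oseen integral equation
`u(t) = e^{(t-s)Δ}u(s) - B¹_s(u,u)(t)` the free (caloric) term carries the decay of the datum;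
this file proves the two facts about it that the bootstrap consumes:

* `exists_norm_heatExtension_le_of_decay` — **polynomial decay is preserved by the heat flow
  on bounded time intervals**: if `‖g y‖ ≤ A (1 + ‖y‖)^{-K}` then
  `‖(e^{tΔ}g)(x)‖ ≤ C(K, S, n) · A · (1 + ‖x‖)^{-K}` for `0 < t ≤ S` (split the convolution at
  `‖y‖ = ‖x‖/2`: near the origin the datum weight is `≤ 2^K (1+‖x‖)^{-K}`, far from it the
  kernel is `≤ 2^{n/2} e^{-‖x‖²/(32t)} G_{2t}(y)`, and `(1+‖x‖)^K e^{-‖x‖²/(32S)}` is bounded);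
* `tendsto_heatExtension_sub_nhdsWithin_zero` — **continuity at the base time**: for a field
  `u` jointly continuous and bounded on `[0,T) × E`, `e^{(τ-s)Δ}u(s)(x) → e^{τΔ}u(0)(x)` as
  `s ↓ 0` (`0 < τ < T`; dominated convergence under the envelope `2^{n/2} M G_τ`). This is how the
  Oseen identity from positive base times (the tree's `mild_of_bounded_of_eLpNorm_two_le_of_lt`,
  stated on open time intervals) is used down to the initial slice.

References: L. Brandolese, Math. Ann. 329 (2004) (arXiv:math/0403136), §2 (decay of the free
term); L. C. Evans, *PDE*, §2.3.1. All statements [folklore].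
-/

noncomputable section

-- single-conjunct summit: `Summit.<Summit>.<Problem>` repeats the name by the D-0017 layout
set_option linter.dupNamespace false

namespace Summit.NavierStokesRegularity.NavierStokesRegularity.Theorems.PlanarEnergyAPriori

open MeasureTheory Set Filter Topology Function Metric Real
open scoped ENNReal NNReal
open Literature.Analysis.UnboundedOperators

variable {E : Type*} [NormedAddCommGroup E] [InnerProductSpace ℝ E] [FiniteDimensional ℝ E]
  [MeasurableSpace E] [BorelSpace E]
variable {F : Type*} [NormedAddCommGroup F] [NormedSpace ℝ F]

/-! ### Elementary weight bounds -/

omit [InnerProductSpace ℝ E] [FiniteDimensional ℝ E] [MeasurableSpace E] [BorelSpace E] in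
/-- **The Gaussian beats every polynomial weight**: for `0 < t'`,
`(1 + ‖x‖)^K exp(-‖x‖²/(16 t')) ≤ 2^K (2 + (16 t')^K K!)`. [folklore] -/
theorem one_add_norm_pow_mul_exp_neg_le {t' : ℝ} (ht' : 0 < t') (K : ℕ) (x : E) :
    (1 + ‖x‖) ^ K * Real.exp (-‖x‖ ^ 2 / (16 * t')) ≤ 2 ^ K * (2 + (16 * t') ^ K * K.factorial) := by
  set e : ℝ := Real.exp (-‖x‖ ^ 2 / (16 * t')) with he
  have he0 : 0 ≤ e := (Real.exp_pos _).le
  have he1 : e ≤ 1 := by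
    rw [he, Real.exp_le_one_iff, neg_div]; exact neg_nonpos.2 (by positivity)
  have hu : 0 ≤ ‖x‖ := norm_nonneg x
  have hgauss : ‖x‖ ^ (2 * K) * e ≤ (16 * t') ^ K * K.factorial := pow_two_mul_mul_exp_neg_le ht' K x
  have hsq : ‖x‖ ^ (2 * K) = (‖x‖ ^ K) ^ 2 := by rw [pow_mul']
  have hK : 2 * ‖x‖ ^ K ≤ 1 + ‖x‖ ^ (2 * K) := by rw [hsq]; nlinarith [sq_nonneg (‖x‖ ^ K - 1)]
  have hmid : ‖x‖ ^ K * e ≤ (1 + (16 * t') ^ K * K.factorial) / 2 := by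
    nlinarith [mul_nonneg (pow_nonneg hu (2 * K)) he0, pow_nonneg hu K]
  -- `(1 + u)^K ≤ 2^K (1 + u^K)` (tree: `BMOInv.one_add_pow_le_two_pow_mul`; three lines here)
  have hpow : (1 + ‖x‖) ^ K ≤ 2 ^ K * (1 + ‖x‖ ^ K) := by
    have h1 : 1 + ‖x‖ ≤ 2 * max 1 ‖x‖ := by
      have := le_max_left 1 ‖x‖; have := le_max_right 1 ‖x‖; linarith
    have h2 : (max 1 ‖x‖) ^ K ≤ 1 + ‖x‖ ^ K := by
      rcases le_total 1 ‖x‖ with h | h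
      · rw [max_eq_right h]; linarith [pow_nonneg hu K]
      · rw [max_eq_left h, one_pow]; linarith [pow_nonneg hu K]
    calc (1 + ‖x‖) ^ K ≤ (2 * max 1 ‖x‖) ^ K := by gcongr
      _ = 2 ^ K * (max 1 ‖x‖) ^ K := mul_pow _ _ _
      _ ≤ 2 ^ K * (1 + ‖x‖ ^ K) := by gcongr
  calc (1 + ‖x‖) ^ K * e ≤ 2 ^ K * (1 + ‖x‖ ^ K) * e := by gcongr
    _ = 2 ^ K * (e + ‖x‖ ^ K * e) := by ring
    _ ≤ 2 ^ K * (1 + (1 + (16 * t') ^ K * K.factorial) / 2) := by gcongr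
    _ ≤ 2 ^ K * (2 + (16 * t') ^ K * K.factorial) := by
        have hX : 0 ≤ (16 * t') ^ K * (K.factorial : ℝ) := by positivity
        exact mul_le_mul_of_nonneg_left (by linarith) (by positivity)

/-! ### The kernel far from the origin -/

omit [FiniteDimensional ℝ E] [MeasurableSpace E] [BorelSpace E] in
/-- **Doubling the time off the diagonal**: if `‖x‖ ≤ 2‖y‖` then
`G_t(y) ≤ 2^{n/2} exp(-‖x‖²/(32 t)) G_{2t}(y)` (`0 < t`), because
`exp(-‖y‖²/(4t)) = exp(-‖y‖²/(8t))² ≤ exp(-‖x‖²/(32t)) exp(-‖y‖²/(8t))` and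
`(4πt)^{-n/2} = 2^{n/2} (8πt)^{-n/2}`. [folklore] -/
theorem heatKernel_le_mul_heatKernel_two_mul_of_norm_le {t : ℝ} (ht : 0 < t) {x y : E}
    (h : ‖x‖ ≤ 2 * ‖y‖) :
    heatKernel t y ≤ (2 : ℝ) ^ ((Module.finrank ℝ E : ℝ) / 2) * Real.exp (-‖x‖ ^ 2 / (32 * t)) *
      heatKernel (2 * t) y := by
  set n : ℝ := (Module.finrank ℝ E : ℝ) with hn
  rw [heatKernel_eq, heatKernel_eq]
  have hpre : (4 * π * t) ^ (-n / 2) = (2 : ℝ) ^ (n / 2) * (4 * π * (2 * t)) ^ (-n / 2) := by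
    rw [show 4 * π * (2 * t) = 2 * (4 * π * t) by ring,
      Real.mul_rpow (by norm_num : (0 : ℝ) ≤ 2) (by positivity)]
    rw [← mul_assoc, ← Real.rpow_add (by norm_num : (0 : ℝ) < 2),
      show n / 2 + -n / 2 = 0 by ring, Real.rpow_zero, one_mul]
  have hexp : Real.exp (-(1 / (4 * t)) * ‖y‖ ^ 2) ≤
      Real.exp (-‖x‖ ^ 2 / (32 * t)) * Real.exp (-(1 / (4 * (2 * t))) * ‖y‖ ^ 2) := by
    rw [← Real.exp_add]
    refine Real.exp_le_exp.2 ?_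
    have hx2 : ‖x‖ ^ 2 ≤ 4 * ‖y‖ ^ 2 := by nlinarith [norm_nonneg x, norm_nonneg y]
    have key : ‖x‖ ^ 2 / (32 * t) ≤ ‖y‖ ^ 2 / (8 * t) := by
      rw [div_le_div_iff₀ (by positivity) (by positivity)]
      nlinarith
    have e1 : -(1 / (4 * t)) * ‖y‖ ^ 2 = -(‖y‖ ^ 2 / (8 * t)) - ‖y‖ ^ 2 / (8 * t) := by
      field_simp; ring
    have e2 : -(1 / (4 * (2 * t))) * ‖y‖ ^ 2 = -(‖y‖ ^ 2 / (8 * t)) := by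
      field_simp; ring
    have e3 : -‖x‖ ^ 2 / (32 * t) = -(‖x‖ ^ 2 / (32 * t)) := by ring
    rw [e1, e2, e3]
    linarith
  calc (4 * π * t) ^ (-n / 2) * Real.exp (-(1 / (4 * t)) * ‖y‖ ^ 2)
      ≤ (4 * π * t) ^ (-n / 2) *
          (Real.exp (-‖x‖ ^ 2 / (32 * t)) * Real.exp (-(1 / (4 * (2 * t))) * ‖y‖ ^ 2)) :=
        mul_le_mul_of_nonneg_left hexp (by positivity)
    _ = (2 : ℝ) ^ (n / 2) * Real.exp (-‖x‖ ^ 2 / (32 * t)) *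
          ((4 * π * (2 * t)) ^ (-n / 2) * Real.exp (-(1 / (4 * (2 * t))) * ‖y‖ ^ 2)) := by
        rw [hpre]; ring

/-! ### Polynomial decay of the caloric extension -/

omit [InnerProductSpace ℝ E] [FiniteDimensional ℝ E] [MeasurableSpace E] [BorelSpace E] in
/-- Conversion of the weight: `(1 + r)^{-K} = ((1 + r)^K)⁻¹` for `0 ≤ r` (natural `K`). [folklore] -/
theorem one_add_rpow_neg_natCast {r : ℝ} (hr : 0 ≤ r) (K : ℕ) :
    (1 + r) ^ (-(K : ℝ)) = ((1 + r) ^ K)⁻¹ := by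
  rw [Real.rpow_neg (by positivity), Real.rpow_natCast]

omit [InnerProductSpace ℝ E] [FiniteDimensional ℝ E] [MeasurableSpace E] [BorelSpace E] in
/-- The datum weight near the origin: if `2‖y‖ ≤ ‖x‖` then
`((1 + ‖x - y‖)^K)⁻¹ ≤ 2^K ((1 + ‖x‖)^K)⁻¹`. [folklore] -/
theorem inv_one_add_norm_sub_pow_le {x y : E} (h : 2 * ‖y‖ ≤ ‖x‖) (K : ℕ) :
    ((1 + ‖x - y‖) ^ K)⁻¹ ≤ 2 ^ K * ((1 + ‖x‖) ^ K)⁻¹ := by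
  have hxy : ‖x‖ ≤ ‖x - y‖ + ‖y‖ := norm_le_norm_sub_add x y
  have hle : 1 + ‖x‖ ≤ 2 * (1 + ‖x - y‖) := by linarith [norm_nonneg (x - y)]
  have hpos : 0 < (1 + ‖x - y‖) ^ K := by positivity
  have hpos' : 0 < (1 + ‖x‖) ^ K := by positivity
  have hb : (1 + ‖x‖) ^ K ≤ 2 ^ K * (1 + ‖x - y‖) ^ K := by
    rw [← mul_pow]; exact pow_le_pow_left₀ (by positivity) hle K
  rw [← div_eq_mul_inv, le_div_iff₀ hpos', inv_mul_le_iff₀ hpos]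
  calc (1 + ‖x‖) ^ K ≤ 2 ^ K * (1 + ‖x - y‖) ^ K := hb
    _ = (1 + ‖x - y‖) ^ K * 2 ^ K := mul_comm _ _

/-- **Polynomial decay is preserved by the heat flow on bounded time intervals.** For every
`K : ℕ` and `S > 0` there is `C = C(K, S, dim E) > 0` such that: if `‖g y‖ ≤ A (1 + ‖y‖)^{-K}`
on `E` (`A ≥ 0`), then `‖(e^{tΔ} g)(x)‖ ≤ C · A · (1 + ‖x‖)^{-K}` for all `0 < t ≤ S` and all `x`.
(Split `∫ G_t(y) g(x-y) dy` at `‖y‖ = ‖x‖/2`: for `2‖y‖ ≤ ‖x‖` the datum weight is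
`≤ 2^K(1+‖x‖)^{-K}` and `∫ G_t = 1`; for `2‖y‖ > ‖x‖` the kernel is
`≤ 2^{n/2} e^{-‖x‖²/(32t)} G_{2t}(y)`, `∫ G_{2t} = 1`, and `(1+‖x‖)^K e^{-‖x‖²/(32S)}` is
bounded.) The free term of a mild solution thus keeps the decay of its datum
(Brandolese 2004, §2). [folklore] -/
theorem exists_norm_heatExtension_le_of_decay (K : ℕ) {S : ℝ} (hS : 0 < S) :
    ∃ C : ℝ, 0 < C ∧ ∀ {g : E → F} {A : ℝ}, 0 ≤ A →
      (∀ y, ‖g y‖ ≤ A * (1 + ‖y‖) ^ (-(K : ℝ))) →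
      ∀ {t : ℝ}, 0 < t → t ≤ S → ∀ x : E,
        ‖heatExtension g t x‖ ≤ C * A * (1 + ‖x‖) ^ (-(K : ℝ)) := by
  set n : ℝ := (Module.finrank ℝ E : ℝ) with hn
  set CK : ℝ := 2 ^ K * (2 + (16 * (2 * S)) ^ K * K.factorial) with hCK
  have hCK0 : 0 < CK := by positivity
  refine ⟨2 ^ K + (2 : ℝ) ^ (n / 2) * CK, by positivity, fun {g A} hA hg {t} ht htS x => ?_⟩
  -- weights as inverses of natural powers
  set W : ℝ := ((1 + ‖x‖) ^ K)⁻¹ with hW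
  have hWpos : 0 < W := by positivity
  have hWx : (1 + ‖x‖) ^ (-(K : ℝ)) = W := one_add_rpow_neg_natCast (norm_nonneg x) K
  have hg' : ∀ z, ‖g z‖ ≤ A * ((1 + ‖z‖) ^ K)⁻¹ := fun z => by
    rw [← one_add_rpow_neg_natCast (norm_nonneg z) K]; exact hg z
  have hgA : ∀ z, ‖g z‖ ≤ A := fun z => by
    refine (hg' z).trans ?_
    have : ((1 + ‖z‖) ^ K)⁻¹ ≤ 1 := inv_le_one_of_one_le₀ (one_le_pow₀ (by simp))
    nlinarith
  rw [hWx, heatExtension_apply]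
  -- the Gaussian factor of the far region
  set γ : ℝ := Real.exp (-‖x‖ ^ 2 / (32 * t)) with hγ
  have hγ0 : 0 ≤ γ := (Real.exp_pos _).le
  have hγW : γ ≤ CK * W := by
    -- `γ ≤ exp(-‖x‖²/(16·2S))` and `(1+‖x‖)^K exp(-‖x‖²/(16·2S)) ≤ CK`
    have h1 : γ ≤ Real.exp (-‖x‖ ^ 2 / (16 * (2 * S))) := by
      refine Real.exp_le_exp.2 ?_
      rw [neg_div, neg_div, neg_le_neg_iff]
      exact div_le_div_of_nonneg_left (by positivity) (by positivity) (by nlinarith)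
    have h2 := one_add_norm_pow_mul_exp_neg_le (by positivity : (0 : ℝ) < 2 * S) K x
    have hpos : 0 < (1 + ‖x‖) ^ K := by positivity
    rw [hW, ← div_eq_mul_inv, le_div_iff₀ hpos]
    calc γ * (1 + ‖x‖) ^ K ≤ Real.exp (-‖x‖ ^ 2 / (16 * (2 * S))) * (1 + ‖x‖) ^ K := by gcongr
      _ = (1 + ‖x‖) ^ K * Real.exp (-‖x‖ ^ 2 / (16 * (2 * S))) := mul_comm _ _
      _ ≤ CK := h2
  -- pointwise bound of the integrand
  set h : E → ℝ := fun y => (2 ^ K * A * W) * heatKernel t y +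
    ((2 : ℝ) ^ (n / 2) * A * γ) * heatKernel (2 * t) y with hh
  have hpt : ∀ y, ‖heatKernel t y • g (x - y)‖ ≤ h y := by
    intro y
    have hGt : 0 ≤ heatKernel t y := (heatKernel_pos ht y).le
    have hG2t : 0 ≤ heatKernel (2 * t) y := (heatKernel_pos (by positivity) y).le
    have hT1 : 0 ≤ (2 ^ K * A * W) * heatKernel t y := by positivity
    have hT2 : 0 ≤ ((2 : ℝ) ^ (n / 2) * A * γ) * heatKernel (2 * t) y := by positivity
    simp only [hh]
    rw [norm_smul, Real.norm_of_nonneg hGt]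
    rcases le_or_gt (2 * ‖y‖) ‖x‖ with hy | hy
    · -- near the origin: the datum weight is `≤ 2^K W`
      have h1 : ‖g (x - y)‖ ≤ 2 ^ K * A * W := by
        calc ‖g (x - y)‖ ≤ A * ((1 + ‖x - y‖) ^ K)⁻¹ := hg' _
          _ ≤ A * (2 ^ K * W) := by gcongr; exact inv_one_add_norm_sub_pow_le hy K
          _ = 2 ^ K * A * W := by ring
      calc heatKernel t y * ‖g (x - y)‖ ≤ heatKernel t y * (2 ^ K * A * W) := by gcongr
        _ = (2 ^ K * A * W) * heatKernel t y := by ring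
        _ ≤ (2 ^ K * A * W) * heatKernel t y +
            ((2 : ℝ) ^ (n / 2) * A * γ) * heatKernel (2 * t) y := le_add_of_nonneg_right hT2
    · -- far from the origin: double the time in the kernel
      have h1 := heatKernel_le_mul_heatKernel_two_mul_of_norm_le ht hy.le
      calc heatKernel t y * ‖g (x - y)‖ ≤
          ((2 : ℝ) ^ (n / 2) * γ * heatKernel (2 * t) y) * A :=
            mul_le_mul h1 (hgA _) (norm_nonneg _) (by positivity)
        _ = ((2 : ℝ) ^ (n / 2) * A * γ) * heatKernel (2 * t) y := by ring
        _ ≤ (2 ^ K * A * W) * heatKernel t y +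
            ((2 : ℝ) ^ (n / 2) * A * γ) * heatKernel (2 * t) y := le_add_of_nonneg_left hT1
  -- integrate
  have hK1 : Integrable (heatKernel (E := E) t) := integrable_heatKernel_holds ht
  have hK2 : Integrable (heatKernel (E := E) (2 * t)) := integrable_heatKernel_holds (by positivity)
  have hhi : Integrable h := (hK1.const_mul _).add (hK2.const_mul _)
  calc ‖∫ y, heatKernel t y • g (x - y)‖ ≤ ∫ y, h y :=
        norm_integral_le_of_norm_le hhi (Eventually.of_forall hpt)
    _ = 2 ^ K * A * W + (2 : ℝ) ^ (n / 2) * A * γ := by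
        rw [hh, integral_add (hK1.const_mul _) (hK2.const_mul _), integral_const_mul,
          integral_const_mul, integral_heatKernel_eq_one_holds ht,
          integral_heatKernel_eq_one_holds (by positivity)]
        ring
    _ ≤ 2 ^ K * A * W + (2 : ℝ) ^ (n / 2) * A * (CK * W) := by gcongr
    _ = (2 ^ K + (2 : ℝ) ^ (n / 2) * CK) * A * W := by ring

/-! ### Continuity of the caloric term at the base time -/

omit [FiniteDimensional ℝ E] [MeasurableSpace E] [BorelSpace E] in
/-- Gaussian envelope on a time window: for `σ ∈ [τ/2, τ]` (`0 < τ`), `G_σ(y) ≤ 2^{n/2} G_τ(y)`.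
[folklore] -/
theorem heatKernel_le_mul_heatKernel_of_mem_Icc {τ : ℝ} (hτ : 0 < τ) {σ : ℝ}
    (hσ : σ ∈ Icc (τ / 2) τ) (y : E) :
    heatKernel σ y ≤ (2 : ℝ) ^ ((Module.finrank ℝ E : ℝ) / 2) * heatKernel τ y := by
  set n : ℝ := (Module.finrank ℝ E : ℝ) with hn
  have hσ0 : 0 < σ := by linarith [hσ.1]
  rw [heatKernel_eq, heatKernel_eq]
  have hpre : (4 * π * σ) ^ (-n / 2) ≤ (2 : ℝ) ^ (n / 2) * (4 * π * τ) ^ (-n / 2) := by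
    have h1 : (4 * π * σ) ^ (-n / 2) ≤ (4 * π * (τ / 2)) ^ (-n / 2) :=
      Real.rpow_le_rpow_of_nonpos (by positivity) (by nlinarith [hσ.1, Real.pi_pos])
        (by rw [neg_div]; exact neg_nonpos.2 (by positivity))
    refine h1.trans (le_of_eq ?_)
    rw [show 4 * π * (τ / 2) = 2⁻¹ * (4 * π * τ) by ring,
      Real.mul_rpow (by norm_num : (0 : ℝ) ≤ 2⁻¹) (by positivity), Real.inv_rpow (by norm_num),
      ← Real.rpow_neg (by norm_num : (0 : ℝ) ≤ 2)]
    congr 1; congr 1; ring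
  have hexp : Real.exp (-(1 / (4 * σ)) * ‖y‖ ^ 2) ≤ Real.exp (-(1 / (4 * τ)) * ‖y‖ ^ 2) := by
    refine Real.exp_le_exp.2 (mul_le_mul_of_nonneg_right (neg_le_neg ?_) (by positivity))
    exact one_div_le_one_div_of_le (by positivity) (by linarith [hσ.2])
  calc (4 * π * σ) ^ (-n / 2) * Real.exp (-(1 / (4 * σ)) * ‖y‖ ^ 2)
      ≤ ((2 : ℝ) ^ (n / 2) * (4 * π * τ) ^ (-n / 2)) * Real.exp (-(1 / (4 * τ)) * ‖y‖ ^ 2) :=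
        mul_le_mul hpre hexp (by positivity) (by positivity)
    _ = _ := by ring

/-- **Continuity of the caloric term at the base time.** Let `u : ℝ → E → F` be jointly
continuous on `[0,T) × E` and bounded there by `M`. Then for `0 < τ < T` and every `x`,
`(e^{(τ-s)Δ} u(s))(x) → (e^{τΔ} u(0))(x)` as `s → 0⁺` (dominated convergence: for `s < τ/2` the
kernels `G_{τ-s}` lie under `2^{n/2} G_τ`, the slices under `M`, and the integrand converges
pointwise by the continuity of `σ ↦ G_σ(y)` and of `u` at `(0, x - y)`). [folklore] -/
theorem tendsto_heatExtension_sub_nhdsWithin_zero {u : ℝ → E → F} {T M : ℝ}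
    (hcont : ContinuousOn (uncurry u) (Ico 0 T ×ˢ univ)) (hM : ∀ s ∈ Ico 0 T, ∀ y, ‖u s y‖ ≤ M)
    {τ : ℝ} (hτ : 0 < τ) (hτT : τ < T) (x : E) :
    Tendsto (fun s => heatExtension (u s) (τ - s) x) (𝓝[>] 0)
      (𝓝 (heatExtension (u 0) τ x)) := by
  set n : ℝ := (Module.finrank ℝ E : ℝ) with hn
  have hM0 : 0 ≤ M := (norm_nonneg _).trans (hM 0 ⟨le_rfl, hτ.trans hτT⟩ 0)
  simp_rw [heatExtension_apply]
  -- the relevant base times: `s ∈ (0, τ/2)`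
  have hwin : ∀ᶠ s in 𝓝[>] (0 : ℝ), s ∈ Ioo 0 (τ / 2) :=
    Ioo_mem_nhdsGT (half_pos hτ)
  have hslice : ∀ s ∈ Ico 0 T, Continuous (u s) := fun s hs =>
    (hcont.comp_continuous (Continuous.prodMk_right s) fun y => ⟨hs, mem_univ y⟩ :)
  refine tendsto_integral_filter_of_dominated_convergence
    (fun y => (2 : ℝ) ^ (n / 2) * M * heatKernel τ y) ?_ ?_ ?_ ?_
  · -- measurability
    filter_upwards [hwin] with s hs
    have hsT : s ∈ Ico 0 T := ⟨hs.1.le, by linarith [hs.2]⟩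
    exact ((continuous_heatKernel _).smul ((hslice s hsT).comp (continuous_sub_left x)))
      |>.aestronglyMeasurable
  · -- domination
    filter_upwards [hwin] with s hs
    refine Eventually.of_forall fun y => ?_
    have hsT : s ∈ Ico 0 T := ⟨hs.1.le, by linarith [hs.2]⟩
    have hστ : τ - s ∈ Icc (τ / 2) τ := ⟨by linarith [hs.2], by linarith [hs.1]⟩
    have hG : 0 ≤ heatKernel (τ - s) y := (heatKernel_pos (by linarith [hs.2]) y).le
    rw [norm_smul, Real.norm_of_nonneg hG]
    calc heatKernel (τ - s) y * ‖u s (x - y)‖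
        ≤ ((2 : ℝ) ^ (n / 2) * heatKernel τ y) * M :=
          mul_le_mul (heatKernel_le_mul_heatKernel_of_mem_Icc hτ hστ y) (hM s hsT _)
            (norm_nonneg _) (mul_nonneg (by positivity) (heatKernel_pos hτ y).le)
      _ = (2 : ℝ) ^ (n / 2) * M * heatKernel τ y := by ring
  · exact (integrable_heatKernel_holds hτ).const_mul _
  · -- pointwise convergence
    refine Eventually.of_forall fun y => ?_
    have h1 : Tendsto (fun s : ℝ => heatKernel (τ - s) y) (𝓝[>] 0) (𝓝 (heatKernel τ y)) := by
      have hc := continuousAt_heatKernel_time hτ y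
      have h2 : Tendsto (fun s : ℝ => τ - s) (𝓝[>] 0) (𝓝 τ) := by
        have : Tendsto (fun s : ℝ => τ - s) (𝓝 0) (𝓝 (τ - 0)) :=
          (continuous_const.sub continuous_id).tendsto 0
        rw [sub_zero] at this
        exact this.mono_left nhdsWithin_le_nhds
      exact hc.tendsto.comp h2
    have h2 : Tendsto (fun s : ℝ => u s (x - y)) (𝓝[>] 0) (𝓝 (u 0 (x - y))) := by
      have hmem : ((0 : ℝ), x - y) ∈ Ico 0 T ×ˢ (univ : Set E) := ⟨⟨le_rfl, hτ.trans hτT⟩, mem_univ _⟩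
      have hcw := hcont.continuousWithinAt hmem
      have h3 : Tendsto (fun s : ℝ => (s, x - y)) (𝓝[>] 0) (𝓝[Ico 0 T ×ˢ univ] (0, x - y)) := by
        refine tendsto_nhdsWithin_iff.2 ⟨?_, ?_⟩
        · exact ((continuous_id.prodMk continuous_const).tendsto 0).mono_left nhdsWithin_le_nhds
        · filter_upwards [Ioo_mem_nhdsGT (hτ.trans hτT)] with s hs
          exact ⟨⟨hs.1.le, hs.2⟩, mem_univ _⟩
      exact hcw.tendsto.comp h3
    exact h1.smul h2

/-! ### The `ℝ³` forms consumed by the decay bootstrap -/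

/-- **Polynomial decay of the caloric extension on `ℝ³` (registered form).** For every `K` and
`S > 0` there is `C > 0` with `‖(e^{tΔ}g)(x)‖ ≤ C A (1 + ‖x‖)^{-K}` for `0 < t ≤ S`, whenever
`‖g y‖ ≤ A (1 + ‖y‖)^{-K}` (`A ≥ 0`). [folklore] -/
theorem exists_norm_heatExtension_le_of_decay_fin3 :
    ∀ (K : ℕ) {S : ℝ}, 0 < S → ∃ C : ℝ, 0 < C ∧
      ∀ {g : EuclideanSpace ℝ (Fin 3) → EuclideanSpace ℝ (Fin 3)} {A : ℝ}, 0 ≤ A →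
      (∀ y, ‖g y‖ ≤ A * (1 + ‖y‖) ^ (-(K : ℝ))) → ∀ {t : ℝ}, 0 < t → t ≤ S → ∀ x,
      ‖Literature.Analysis.UnboundedOperators.heatExtension g t x‖ ≤
        C * A * (1 + ‖x‖) ^ (-(K : ℝ)) :=
  fun K _ hS => exists_norm_heatExtension_le_of_decay K hS

/-- **Continuity of the caloric term at the base time on `ℝ³` (explicit form).** [folklore] -/
theorem tendsto_heatExtension_sub_nhdsWithin_zero_fin3 :
    ∀ {u : ℝ → EuclideanSpace ℝ (Fin 3) → EuclideanSpace ℝ (Fin 3)} {T M : ℝ},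
      ContinuousOn (Function.uncurry u) (Set.Ico 0 T ×ˢ Set.univ) →
      (∀ s ∈ Set.Ico 0 T, ∀ y, ‖u s y‖ ≤ M) → ∀ {τ : ℝ}, 0 < τ → τ < T → ∀ x,
      Filter.Tendsto (fun s => Literature.Analysis.UnboundedOperators.heatExtension (u s) (τ - s) x)
        (nhdsWithin 0 (Set.Ioi 0))
        (nhds (Literature.Analysis.UnboundedOperators.heatExtension (u 0) τ x)) :=
  fun hcont hM _ hτ hτT x => tendsto_heatExtension_sub_nhdsWithin_zero hcont hM hτ hτT x

end Summit.NavierStokesRegularity.NavierStokesRegularity.Theorems.PlanarEnergyAPriori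

end
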